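import Literature.NumberTheory.Sieve.HeathBrownCubicTypeIIGenerators
import Literature.NumberTheory.Sieve.HeathBrownCubicTypeIIWeightBounds
import Literature.NumberTheory.Sieve.HeathBrownCubicLemma47
import HarnessLib

/-!
# Heath-Brown's Lemma 3.10, §11 p. 67: `S_V = (main term) + E_V`, `E_V ≪ X^{2−τ/2}(log X)^c`

Support for the proof of **Lemma 3.10** of D. R. Heath-Brown, *Primes represented by `x³ + 2y³`*,
Acta Math. 186 (2001), §11 pp. 66–68 (see `HeathBrownCubicTypeIIGenerators` for the quotation). Here
we carry out, for the sum `S_V` of Lemma 3.10 in the tree's form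
`bilin (boxPairs X η) pairIdeal c_R g` with `g_S = f_S · [V < N(S) ≤ 2V]`, the steps

> "`S_V = ∑_{d ≪ X} μ(d) ∑_{R ∈ 𝒫} c_R ∑_{S ∈ 𝒫} f_S ∑_{d ∣ 𝐱, (x + y2^{1/3}) = RS} W(𝐱)` … We may
> therefore conclude that `S_V = ∑_{R ∈ 𝒫} c_R ∑_{S ∈ 𝒫} f_S ∑_{(x+y2^{1/3}) = RS} W(𝐱) + E_V`, where
> the error term `E_V` satisfies `E_V ≪ ∑_{X^{τ/2} ≤ d ≪ X} ∑_R ∑_S |f_S| ∑_{d ∣ 𝐱} W(𝐱)` … Thus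
> `E_V ≪ log X ∑_{X^{τ/2} ≤ d ≪ X} ∑_{d ∣ 𝐱} W(𝐱) τ(x + y2^{1/3})² ≪ … ≪ X^{2−τ/2}(log X)^c` (11.2)
> by Lemmas 4.7 and 4.2."

All PROVED:
* `gCut` (`g_S`), `Hprim` (the `(x, y)`-summand with the primitivity of `α̂`, `β̂` made explicit:
  `∑_{β ∈ winDivs T γ} [β̂, α̂ primitive] c_{(α)} g_{(β)}`, `γ = x + y2^{1/3}`, `α = γ/β`);
* **`bilin_eq_sum_Hprim`**: `S_V = ∑_{(x,y) ∈ box, (x,y)=1} Hprim(x,y)`;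
* **`bilin_eq_main_add_error`**: `S_V = M_V + E_V` with `M_V = ∑_{(x,y) ∈ box} Hprim(x,y)` and
  `E_V = ∑_{2 ≤ d} μ(d) ∑_{d ∣ x, y} Hprim(x,y)` (Möbius over the g.c.d.);
* `Hprim_eq_zero_of_dvd` — the summands with `2 ≤ d < X^τ`, `d ∣ x, y` vanish (the "`d ≥ X^{τ/2}`" step);
* `abs_Hprim_le` (`|Hprim| ≤ 9 τ((γ))²`, from `|f_S| ≤ 9τ(S)` and `∑_{S ∣ (γ)} 1 ≤ τ((γ))`), and
  **`abs_errorEV_le`**: `|E_V| ≤ 9 ∑_{(x,y) ∈ box, gcd(x,y) ≥ X^τ} τ((x + y2^{1/3}))² τ(gcd(x,y))`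
  (instead of splitting off `τ((d))` as in the printed `∑_d τ(d)^c ∑_{m,n ≪ X/d} τ(m + n2^{1/3})²`, we
  count the `d`'s dividing a given pair), followed by Cauchy–Schwarz
  **`abs_errorEV_le_sqrt`**: `|E_V| ≤ 9 (∑_{box} τ(γ)⁴)^{1/2} (∑_{box, gcd ≥ X^τ} τ(gcd)²)^{1/2}`, whose
  two factors are bounded by Lemma 4.7 (`A = 4`) and by the elementary
  `sum_box_gcd_ge_sigma_sq_le` (`≤ N² G⁻¹ ∑_{g ≤ N} τ(g)²/g`), giving the printed
  `E_V ≪ X^{2−τ/2}(log X)^c` in **`exists_errorEV_bound`**.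

## References

* D. R. Heath-Brown, *Primes represented by `x³ + 2y³`*, Acta Math. 186 (2001), §11 pp. 66–68, (11.2).
  [cite: HeathBrownActa2001, §11 (11.2)]
* G. Harman, *Prime-Detecting Sieves* (2007), §13.8, (13.8.1). [cite: Harman2007, §13.8]

## Mathlib / tree search

Tree: `HeathBrownCubicTypeIIGenerators` (`winDivs`, `sum_divisorPairs_eq_sum_winDivs`, `box`,
`sum_filter_coprime_eq_sum_moebius`, `rpow_le_of_dvdVec_of_ne_zero`, `isPrimitiveVec_of_dvd_pairElt`),
`HeathBrownCubicTypeIIWeightBounds` (`abs_fWeight_le`), `HeathBrownCubicLemma47` (Lemma 4.7),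
`DivisorPowerSums` (`exists_sum_sigma_zero_pow_div_le_real`), `HeathBrownCubicTypeITools`
(`idealDivisorCount_le_of_dvd`). Mathlib: `Real.sum_mul_le_sqrt_mul_sqrt` (Cauchy–Schwarz with square roots),
`Real.sqrt_le_sqrt`, `Nat.Ioc_filter_dvd_card_eq_div`.
-/

noncomputable section

open Finset NumberField

open scoped ArithmeticFunction.Moebius ArithmeticFunction.sigma

namespace Literature.NumberTheory.Sieve.CubicSieve

open LFunctions.CubeRootTwoField CubicPrimes

section Defs

variable (X τ : ℝ) {k : ℕ} (m : Fin k → ℕ) (V T : ℝ) (c : Ideal (𝓞 K) → ℝ)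

/-- `g_S = f_S(𝐦) · [V < N(S) ≤ 2V]`, the second weight of `S_V` in Lemma 3.10. [cite: HeathBrownActa2001, §11 (11.1)] -/
def gCut (S : Ideal (𝓞 K)) : ℝ :=
  if V < (Ideal.absNorm S : ℝ) ∧ (Ideal.absNorm S : ℝ) ≤ 2 * V then fWeight X τ m S else 0

open scoped Classical in
/-- **The `(x, y)`-summand after passing to generators**, with the primitivity of `β̂` and `α̂` made
explicit: `Hprim(x,y) = ∑_{β ∈ winDivs T γ} [β̂ primitive][α̂ primitive] c_{(α)} g_{(β)}`,
`γ = x + y2^{1/3}`, `α = γ/β` (for `(x, y) = 1` the two brackets are automatically `1`).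
[cite: HeathBrownActa2001, §11 p. 67] -/
def Hprim (xy : ℕ × ℕ) : ℝ :=
  ∑ β ∈ winDivs T (pairElt xy),
    if IsPrimitiveVec (coordVec β) ∧ IsPrimitiveVec (coordVec (quo (pairElt xy) β)) then
      c (Ideal.span {quo (pairElt xy) β}) * gCut X τ m V (Ideal.span {β}) else 0

open scoped Classical in
/-- **The error `E_V`**: the terms `d ≥ 2` of the Möbius inversion over `gcd(x, y)`,
`E_V = ∑_{2 ≤ d ≤ X(1+η)} μ(d) ∑_{(x,y) ∈ box, d ∣ x, d ∣ y} Hprim(x,y)`. [cite: HeathBrownActa2001, §11 (11.2)] -/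
def errorEV (η : ℝ) : ℝ :=
  ∑ d ∈ Icc 2 ⌊X * (1 + η)⌋₊, (μ d : ℝ) *
    ∑ xy ∈ (box X η).filter (fun xy => d ∣ xy.1 ∧ d ∣ xy.2), Hprim X τ m V T c xy

/-- **The main term** (the `d = 1` term): `M_V = ∑_{(x,y) ∈ box} Hprim(x,y)` — Heath-Brown's
`∑_{α ∈ Q} c_{(α)} ∑_β F_β ∑_{x + y2^{1/3} = αβ} W(𝐱)` before Cauchy's inequality.
[cite: HeathBrownActa2001, §11 p. 68] -/
def mainMV (η : ℝ) : ℝ := ∑ xy ∈ box X η, Hprim X τ m V T c xy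

end Defs

variable {X η τ V T : ℝ} {k : ℕ} {m : Fin k → ℕ} {c : Ideal (𝓞 K) → ℝ}

/-! ### `S_V` as a sum of `Hprim` over coprime pairs -/

/-- `coordElt v = 0 ↔ v = 0`. [folklore] -/
theorem coordElt_eq_zero_iff (v : ℤ × ℤ × ℤ) : coordElt v = 0 ↔ v = 0 := by
  constructor
  · intro h
    apply coordElt_injective
    rw [h]; simp [coordElt]
  · rintro rfl; simp [coordElt]

/-- `x + y2^{1/3} ≠ 0` for `x ≠ 0`. [folklore] -/
theorem pairElt_ne_zero {xy : ℕ × ℕ} (hx : xy.1 ≠ 0) : pairElt xy ≠ 0 := by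
  rw [pairElt_eq_coordElt, Ne, coordElt_eq_zero_iff]
  intro h
  have := congrArg Prod.fst h
  simp at this
  exact hx this

/-- Elements of the box have `x, y ≥ 1` when `X ≥ 0`. [folklore] -/
theorem one_le_of_mem_box (hX : 0 ≤ X) {xy : ℕ × ℕ} (h : xy ∈ box X η) : 1 ≤ xy.1 ∧ 1 ≤ xy.2 := by
  rw [mem_box_iff] at h
  obtain ⟨h1, -, h2, -⟩ := h
  have a : (0 : ℝ) < xy.1 := lt_of_le_of_lt hX h1
  have b : (0 : ℝ) < xy.2 := lt_of_le_of_lt hX h2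
  exact ⟨Nat.one_le_iff_ne_zero.mpr (by rintro h; simp [h] at a),
    Nat.one_le_iff_ne_zero.mpr (by rintro h; simp [h] at b)⟩

open scoped Classical in
/-- **`S_V = ∑_{(x,y) = 1} Hprim(x, y)`**: the bilinear sum of Lemma 3.10 written over generators
("we now replace `R` and `S` by their generators … `x + y2^{1/3} = αβ`"; for coprime `(x, y)` the
vectors `α̂`, `β̂` are automatically primitive). [cite: HeathBrownActa2001, §11 pp. 67–68] -/
theorem bilin_eq_sum_Hprim (hX : 0 ≤ X) (hT : 0 < T) :
    bilin (boxPairs X η) pairIdeal c (gCut X τ m V) =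
      ∑ xy ∈ (box X η).filter (fun xy => Nat.Coprime xy.1 xy.2), Hprim X τ m V T c xy := by
  classical
  rw [bilin, boxPairs_eq_filter_box]
  refine sum_congr rfl fun xy hxy => ?_
  rw [mem_filter] at hxy
  obtain ⟨hbox, hcop⟩ := hxy
  have hx1 := (one_le_of_mem_box hX hbox).1
  have hγ : pairElt xy ≠ 0 := pairElt_ne_zero (by omega)
  rw [pairIdeal, sum_divisorPairs_eq_sum_winDivs hT hγ, Hprim]
  refine sum_congr rfl fun β hβ => ?_
  rw [mem_winDivs_iff hT hγ] at hβ
  have hq : quo (pairElt xy) β ∣ pairElt xy := ⟨β, by rw [mul_comm]; exact eq_mul_quo hβ.2⟩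
  rw [if_pos ⟨isPrimitiveVec_of_dvd_pairElt hcop hβ.2, isPrimitiveVec_of_dvd_pairElt hcop hq⟩]

open scoped Classical in
/-- **`S_V = M_V + E_V`** (Möbius inversion over `gcd(x, y)`; the `d = 1` term is the main term).
[cite: HeathBrownActa2001, §11 p. 67] -/
theorem bilin_eq_main_add_error (hX : 0 ≤ X) (hT : 0 < T) :
    bilin (boxPairs X η) pairIdeal c (gCut X τ m V) = mainMV X τ m V T c η + errorEV X τ m V T c η := by
  classical
  rw [bilin_eq_sum_Hprim hX hT]
  set D : ℕ := ⌊X * (1 + η)⌋₊ with hD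
  have hbound : ∀ xy ∈ box X η, xy.1 ≤ D := fun xy hxy => by
    rw [mem_box_iff] at hxy; exact Nat.le_floor hxy.2.1
  rw [sum_filter_coprime_eq_sum_moebius (box X η) _ (fun xy hxy => (one_le_of_mem_box hX hxy).1) hbound]
  -- split off `d = 1`
  rcases Nat.eq_zero_or_pos D with hD0 | hDpos
  · -- empty box
    have hbox : box X η = ∅ := by
      rw [eq_empty_iff_forall_notMem]
      intro xy hxy
      have h1 := (one_le_of_mem_box hX hxy).1
      have h2 := hbound xy hxy
      omega
    simp [mainMV, errorEV, hbox]
  · have hsplit : Icc 1 D = insert 1 (Icc 2 D) := by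
      ext d; simp only [mem_Icc, mem_insert]; omega
    rw [hsplit, sum_insert (by simp), mainMV, errorEV, ← hD]
    congr 1
    rw [ArithmeticFunction.moebius_apply_one, Int.cast_one, one_mul]
    refine sum_congr ?_ fun _ _ => rfl
    ext xy; simp

/-! ### The terms `2 ≤ d < X^τ` vanish -/

open scoped Classical in
/-- For `2 ≤ d < X^τ` dividing `x` and `y`, `Hprim(x, y) = 0` (every potentially nonzero `β`-term has
`c_{(α)} ≠ 0` with `α̂`, `β̂` primitive, forcing `d ≥ X^τ`). [cite: HeathBrownActa2001, §11 p. 67] -/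
theorem Hprim_eq_zero_of_dvd (hc : CSupport X τ c) (hT : 0 < T) {d : ℕ} (hd : 2 ≤ d)
    (hdX : (d : ℝ) < X ^ τ) {xy : ℕ × ℕ} (hx : xy.1 ≠ 0) (h1 : d ∣ xy.1) (h2 : d ∣ xy.2) :
    Hprim X τ m V T c xy = 0 := by
  classical
  rw [Hprim]
  refine sum_eq_zero fun β hβ => ?_
  split_ifs with hprim
  · by_contra hne
    have hcα : c (Ideal.span {quo (pairElt xy) β}) ≠ 0 := by
      intro h0; rw [h0, zero_mul] at hne; exact hne rfl
    have hγ : pairElt xy ≠ 0 := pairElt_ne_zero hx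
    rw [mem_winDivs_iff hT hγ] at hβ
    have hαβ : quo (pairElt xy) β * β = coordElt ((xy.1 : ℤ), (xy.2 : ℤ), 0) := by
      rw [← pairElt_eq_coordElt, mul_comm]; exact (eq_mul_quo hβ.2).symm
    have hdv : DvdVec (d : ℤ) ((xy.1 : ℤ), (xy.2 : ℤ), (0 : ℤ)) :=
      ⟨Int.natCast_dvd_natCast.mpr h1, Int.natCast_dvd_natCast.mpr h2, dvd_zero _⟩
    have := rpow_le_of_dvdVec_of_ne_zero hc hd hdv hαβ hprim.1 hcα
    linarith
  · rfl

/-! ### The size of `Hprim` and of `E_V` -/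

/-- `|g_S| ≤ 9 τ(S)` (from `|f_S| ≤ 9 τ(S)`, Lemma "`f_S ≪ τ(S) log X`" of p. 67 in the tree's
sharper form). [cite: HeathBrownActa2001, §11 p. 67] -/
theorem abs_gCut_le (hX : 1 < X) (hτ : 0 < τ) (hτ1 : τ ≤ 1) {n : ℕ} {m : Fin (n + 1) → ℕ}
    (hm : CoreAdmissible τ m) (V : ℝ) (S : Ideal (𝓞 K)) :
    |gCut X τ m V S| ≤ 9 * (idealDivisorCount S : ℝ) := by
  rw [gCut]
  split_ifs
  · exact abs_fWeight_le hX hτ hτ1 hm S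
  · rw [abs_zero]; positivity

open scoped Classical in
/-- `#winDivs T γ ≤ τ((γ))` (one window generator per nonzero divisor). [folklore] -/
theorem card_winDivs_le (T : ℝ) (γ : 𝓞 K) : #(winDivs T γ) ≤ idealDivisorCount (Ideal.span {γ}) := by
  classical
  rw [winDivs]
  refine card_image_le.trans ?_
  rw [← card_idealDivisors]
  exact card_filter_le _ _

open scoped Classical in
/-- **`|Hprim(x, y)| ≤ 9 τ((γ))²`**, `γ = x + y2^{1/3}` (`|c| ≤ 1`, `|g_{(β)}| ≤ 9τ((β)) ≤ 9τ((γ))`,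
at most `τ((γ))` values of `β`). [cite: HeathBrownActa2001, §11 p. 67] -/
theorem abs_Hprim_le (hX : 1 < X) (hτ : 0 < τ) (hτ1 : τ ≤ 1) {n : ℕ} {m : Fin (n + 1) → ℕ}
    (hm : CoreAdmissible τ m) (hc : CSupport X τ c) (hT : 0 < T) {xy : ℕ × ℕ} (hx : xy.1 ≠ 0) :
    |Hprim X τ m V T c xy| ≤ 9 * (idealDivisorCount (Ideal.span {pairElt xy}) : ℝ) ^ 2 := by
  classical
  have hγ : pairElt xy ≠ 0 := pairElt_ne_zero hx
  have hI : Ideal.span {pairElt xy} ≠ ⊥ := by rwa [Ne, Ideal.span_singleton_eq_bot]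
  rw [Hprim]
  refine (abs_sum_le_sum_abs _ _).trans ?_
  have hterm : ∀ β ∈ winDivs T (pairElt xy),
      |(if IsPrimitiveVec (coordVec β) ∧ IsPrimitiveVec (coordVec (quo (pairElt xy) β)) then
          c (Ideal.span {quo (pairElt xy) β}) * gCut X τ m V (Ideal.span {β}) else 0)| ≤
        9 * (idealDivisorCount (Ideal.span {pairElt xy}) : ℝ) := by
    intro β hβ
    rw [mem_winDivs_iff hT hγ] at hβ
    split_ifs
    · rw [abs_mul]
      have hc1 : |c (Ideal.span {quo (pairElt xy) β})| ≤ 1 := by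
        rcases hc.1 (Ideal.span {quo (pairElt xy) β}) with h | h <;> rw [h] <;> norm_num
      have hg := abs_gCut_le hX hτ hτ1 hm V (Ideal.span {β})
      have hτle : (idealDivisorCount (Ideal.span {β}) : ℝ) ≤ idealDivisorCount (Ideal.span {pairElt xy}) := by
        exact_mod_cast idealDivisorCount_le_of_dvd hI
          (Ideal.dvd_iff_le.mpr (Ideal.span_singleton_le_span_singleton.mpr hβ.2))
      calc |c (Ideal.span {quo (pairElt xy) β})| * |gCut X τ m V (Ideal.span {β})|
          ≤ 1 * (9 * (idealDivisorCount (Ideal.span {β}) : ℝ)) :=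
            mul_le_mul hc1 hg (abs_nonneg _) zero_le_one
        _ ≤ 9 * (idealDivisorCount (Ideal.span {pairElt xy}) : ℝ) := by linarith
    · rw [abs_zero]; positivity
  calc ∑ β ∈ winDivs T (pairElt xy), _ ≤ ∑ _β ∈ winDivs T (pairElt xy),
        9 * (idealDivisorCount (Ideal.span {pairElt xy}) : ℝ) := sum_le_sum hterm
    _ = #(winDivs T (pairElt xy)) * (9 * (idealDivisorCount (Ideal.span {pairElt xy}) : ℝ)) := by
        rw [sum_const, nsmul_eq_mul]
    _ ≤ (idealDivisorCount (Ideal.span {pairElt xy}) : ℝ) *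
          (9 * (idealDivisorCount (Ideal.span {pairElt xy}) : ℝ)) := by
        gcongr; exact_mod_cast card_winDivs_le T (pairElt xy)
    _ = 9 * (idealDivisorCount (Ideal.span {pairElt xy}) : ℝ) ^ 2 := by ring

open scoped Classical in
/-- **`|E_V| ≤ 9 ∑_{(x,y) ∈ box, gcd(x,y) ≥ X^τ} τ((x + y2^{1/3}))² τ(gcd(x, y))`**: the terms
`d < X^τ` vanish, `|μ| ≤ 1`, and a pair `(x, y)` occurs for at most `τ(gcd(x,y))` values of `d`
("`E_V ≪ log X ∑_{X^{τ/2} ≤ d ≪ X} ∑_{d ∣ 𝐱} W(𝐱) τ(x + y2^{1/3})²`", (11.2)). [cite: HeathBrownActa2001, §11 (11.2)] -/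
theorem abs_errorEV_le (hX : 1 < X) (hτ : 0 < τ) (hτ1 : τ ≤ 1) {n : ℕ} {m : Fin (n + 1) → ℕ}
    (hm : CoreAdmissible τ m) (hc : CSupport X τ c) (hT : 0 < T) :
    |errorEV X τ m V T c η| ≤
      9 * ∑ xy ∈ (box X η).filter (fun xy => X ^ τ ≤ (Nat.gcd xy.1 xy.2 : ℝ)),
        (idealDivisorCount (Ideal.span {pairElt xy}) : ℝ) ^ 2 * (σ 0 (Nat.gcd xy.1 xy.2) : ℝ) := by
  classical
  have hX0 : 0 ≤ X := by linarith
  set D : ℕ := ⌊X * (1 + η)⌋₊ with hD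
  rw [errorEV, ← hD]
  -- termwise bound: `|μ(d) ∑_{d ∣ xy} Hprim| ≤ ∑_{xy ∈ box} [d ∣ x, d ∣ y, X^τ ≤ d] 9τ²`
  have hterm : ∀ d ∈ Icc 2 D,
      |(μ d : ℝ) * ∑ xy ∈ (box X η).filter (fun xy => d ∣ xy.1 ∧ d ∣ xy.2), Hprim X τ m V T c xy| ≤
        ∑ xy ∈ box X η, if d ∣ xy.1 ∧ d ∣ xy.2 ∧ X ^ τ ≤ (d : ℝ) then
          9 * (idealDivisorCount (Ideal.span {pairElt xy}) : ℝ) ^ 2 else 0 := by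
    intro d hd
    rw [mem_Icc] at hd
    rw [abs_mul]
    have hμ : |(μ d : ℝ)| ≤ 1 := by exact_mod_cast ArithmeticFunction.abs_moebius_le_one
    calc |(μ d : ℝ)| * |∑ xy ∈ (box X η).filter (fun xy => d ∣ xy.1 ∧ d ∣ xy.2), Hprim X τ m V T c xy|
        ≤ 1 * ∑ xy ∈ (box X η).filter (fun xy => d ∣ xy.1 ∧ d ∣ xy.2), |Hprim X τ m V T c xy| :=
          mul_le_mul hμ (abs_sum_le_sum_abs _ _) (abs_nonneg _) zero_le_one
      _ = ∑ xy ∈ box X η, if d ∣ xy.1 ∧ d ∣ xy.2 then |Hprim X τ m V T c xy| else 0 := by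
          rw [one_mul, sum_filter]
      _ ≤ _ := by
          refine sum_le_sum fun xy hxy => ?_
          have hx1 := (one_le_of_mem_box hX0 hxy).1
          by_cases hdvd : d ∣ xy.1 ∧ d ∣ xy.2
          · rw [if_pos hdvd]
            by_cases hdX : X ^ τ ≤ (d : ℝ)
            · rw [if_pos ⟨hdvd.1, hdvd.2, hdX⟩]
              exact abs_Hprim_le hX hτ hτ1 hm hc hT (by omega)
            · rw [if_neg (fun h => hdX h.2.2)]
              push Not at hdX
              rw [Hprim_eq_zero_of_dvd hc hT hd.1 hdX (by omega) hdvd.1 hdvd.2, abs_zero]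
          · rw [if_neg hdvd, if_neg (fun h => hdvd ⟨h.1, h.2.1⟩)]
  refine (abs_sum_le_sum_abs _ _).trans ((sum_le_sum hterm).trans ?_)
  -- swap the sums and count the `d`'s
  rw [sum_comm, mul_sum, sum_filter]
  refine sum_le_sum fun xy hxy => ?_
  have hx1 := (one_le_of_mem_box hX0 hxy).1
  set g : ℕ := Nat.gcd xy.1 xy.2 with hg
  have hg0 : g ≠ 0 := by rw [hg, Ne, Nat.gcd_eq_zero_iff]; omega
  -- the `d` with `d ∣ x`, `d ∣ y`, `X^τ ≤ d` are divisors of `g`, and force `X^τ ≤ g`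
  have hsub : ∀ d ∈ Icc 2 D, d ∣ xy.1 ∧ d ∣ xy.2 ∧ X ^ τ ≤ (d : ℝ) → d ∈ g.divisors ∧ X ^ τ ≤ (g : ℝ) := by
    intro d _ ⟨h1, h2, h3⟩
    have hdg : d ∣ g := Nat.dvd_gcd h1 h2
    refine ⟨Nat.mem_divisors.mpr ⟨hdg, hg0⟩, h3.trans ?_⟩
    exact_mod_cast Nat.le_of_dvd (Nat.pos_of_ne_zero hg0) hdg
  by_cases hG : X ^ τ ≤ (g : ℝ)
  · rw [if_pos hG]
    calc ∑ d ∈ Icc 2 D, (if d ∣ xy.1 ∧ d ∣ xy.2 ∧ X ^ τ ≤ (d : ℝ) then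
            9 * (idealDivisorCount (Ideal.span {pairElt xy}) : ℝ) ^ 2 else 0)
        ≤ ∑ d ∈ g.divisors, 9 * (idealDivisorCount (Ideal.span {pairElt xy}) : ℝ) ^ 2 := by
          rw [← sum_filter]
          refine sum_le_sum_of_subset_of_nonneg (fun d hd => ?_) (fun _ _ _ => by positivity)
          rw [mem_filter] at hd
          exact (hsub d hd.1 hd.2).1
      _ = 9 * ((idealDivisorCount (Ideal.span {pairElt xy}) : ℝ) ^ 2 * (σ 0 g : ℝ)) := by
          rw [sum_const, nsmul_eq_mul, ArithmeticFunction.sigma_zero_apply]; ring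
  · rw [if_neg hG]
    refine (sum_eq_zero fun d hd => ?_).le
    rw [if_neg]
    intro h
    exact hG (hsub d hd h).2

open scoped Classical in
/-- **`|E_V| ≤ 9 (∑_{box} τ(γ)⁴)^{1/2} (∑_{box, gcd ≥ X^τ} τ(gcd)²)^{1/2}`** (Cauchy–Schwarz on
`abs_errorEV_le`). [cite: HeathBrownActa2001, §11 (11.2)] -/
theorem abs_errorEV_le_sqrt (hX : 1 < X) (hτ : 0 < τ) (hτ1 : τ ≤ 1) {n : ℕ} {m : Fin (n + 1) → ℕ}
    (hm : CoreAdmissible τ m) (hc : CSupport X τ c) (hT : 0 < T) :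
    |errorEV X τ m V T c η| ≤
      9 * Real.sqrt (∑ xy ∈ box X η, (idealDivisorCount (Ideal.span {pairElt xy}) : ℝ) ^ 4) *
        Real.sqrt (∑ xy ∈ (box X η).filter (fun xy => X ^ τ ≤ (Nat.gcd xy.1 xy.2 : ℝ)),
          (σ 0 (Nat.gcd xy.1 xy.2) : ℝ) ^ 2) := by
  classical
  refine (abs_errorEV_le hX hτ hτ1 hm hc hT).trans ?_
  set F := (box X η).filter (fun xy => X ^ τ ≤ (Nat.gcd xy.1 xy.2 : ℝ)) with hF
  have hcs := Real.sum_mul_le_sqrt_mul_sqrt F (fun xy => (idealDivisorCount (Ideal.span {pairElt xy}) : ℝ) ^ 2)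
    (fun xy => (σ 0 (Nat.gcd xy.1 xy.2) : ℝ))
  have hmono : Real.sqrt (∑ xy ∈ F, ((idealDivisorCount (Ideal.span {pairElt xy}) : ℝ) ^ 2) ^ 2) ≤
      Real.sqrt (∑ xy ∈ box X η, (idealDivisorCount (Ideal.span {pairElt xy}) : ℝ) ^ 4) := by
    apply Real.sqrt_le_sqrt
    simp_rw [← pow_mul]
    exact sum_le_sum_of_subset_of_nonneg (filter_subset _ _) fun _ _ _ => by positivity
  rw [mul_assoc]
  refine mul_le_mul_of_nonneg_left (hcs.trans ?_) (by norm_num)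
  exact mul_le_mul_of_nonneg_right hmono (Real.sqrt_nonneg _)

/-! ### The two factors: Lemma 4.7 and an elementary count -/

open scoped Classical in
/-- The box sum of `τ((x + y2^{1/3}))^A` is a sub-sum of Lemma 4.7's sum with `X = Y = ⌊X(1+η)⌋`.
[cite: HeathBrownActa2001, Lemma 4.7] -/
theorem sum_box_idealDivisorCount_pow_le (A : ℕ) (hX : 0 ≤ X) :
    ∑ xy ∈ box X η, (idealDivisorCount (Ideal.span {pairElt xy}) : ℝ) ^ A ≤
      ∑ v ∈ ((Icc (-(⌊X * (1 + η)⌋₊ : ℤ)) ⌊X * (1 + η)⌋₊) ×ˢ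
          (Icc (-(⌊X * (1 + η)⌋₊ : ℤ)) ⌊X * (1 + η)⌋₊)).filter (· ≠ 0),
        (idealDivisorCount (Ideal.span {(v.1 : 𝓞 K) + (v.2 : 𝓞 K) * θint}) : ℝ) ^ A := by
  classical
  set N : ℕ := ⌊X * (1 + η)⌋₊ with hN
  have hinj : Set.InjOn (fun xy : ℕ × ℕ => ((xy.1 : ℤ), (xy.2 : ℤ))) (box X η : Set (ℕ × ℕ)) := by
    intro a _ b _ h
    simp only [Prod.mk.injEq, Nat.cast_inj] at h
    exact Prod.ext h.1 h.2
  calc ∑ xy ∈ box X η, (idealDivisorCount (Ideal.span {pairElt xy}) : ℝ) ^ A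
      = ∑ v ∈ (box X η).image (fun xy : ℕ × ℕ => ((xy.1 : ℤ), (xy.2 : ℤ))),
          (idealDivisorCount (Ideal.span {(v.1 : 𝓞 K) + (v.2 : 𝓞 K) * θint}) : ℝ) ^ A := by
        rw [sum_image hinj]
        refine sum_congr rfl fun xy _ => ?_
        rw [pairElt_eq_intCast]
    _ ≤ _ := by
        refine sum_le_sum_of_subset_of_nonneg (fun v hv => ?_) (fun _ _ _ => by positivity)
        obtain ⟨xy, hxy, rfl⟩ := mem_image.mp hv
        have h1 := one_le_of_mem_box hX hxy
        have hb : xy.1 ≤ N ∧ xy.2 ≤ N := by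
          rw [mem_box_iff] at hxy; exact ⟨Nat.le_floor hxy.2.1, Nat.le_floor hxy.2.2.2⟩
        simp only [mem_filter, mem_product, mem_Icc, ne_eq, Prod.ext_iff, Prod.fst_zero,
          Prod.snd_zero, Nat.cast_eq_zero]
        refine ⟨⟨⟨by omega, by exact_mod_cast hb.1⟩, ⟨by omega, by exact_mod_cast hb.2⟩⟩, by omega⟩

open scoped Classical in
/-- **`∑_{(x,y) ∈ box, gcd(x,y) ≥ G} τ(gcd(x,y))² ≤ N² G⁻¹ ∑_{g ≤ N} τ(g)²/g`**, `N = ⌊X(1+η)⌋`,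
`G ≥ 1` (each pair is counted at `g = gcd(x, y)`; `#{(x, y) : g ∣ x, g ∣ y} ≤ (N/g)²`; `g⁻² ≤ G⁻¹g⁻¹`).
[folklore] -/
theorem sum_box_gcd_ge_sigma_sq_le (hX : 0 ≤ X) {G : ℝ} (hG : 1 ≤ G) :
    ∑ xy ∈ (box X η).filter (fun xy => G ≤ (Nat.gcd xy.1 xy.2 : ℝ)), (σ 0 (Nat.gcd xy.1 xy.2) : ℝ) ^ 2 ≤
      (⌊X * (1 + η)⌋₊ : ℝ) ^ 2 * G⁻¹ * ∑ g ∈ Icc 1 ⌊X * (1 + η)⌋₊, (σ 0 g : ℝ) ^ 2 / g := by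
  classical
  set N : ℕ := ⌊X * (1 + η)⌋₊ with hN
  have hG0 : 0 < G := by linarith
  -- Step 1: each pair is counted at `g = gcd`
  have step1 : ∑ xy ∈ (box X η).filter (fun xy => G ≤ (Nat.gcd xy.1 xy.2 : ℝ)),
      (σ 0 (Nat.gcd xy.1 xy.2) : ℝ) ^ 2 ≤
      ∑ xy ∈ box X η, ∑ g ∈ (Icc 1 N).filter (fun g : ℕ => G ≤ (g : ℝ) ∧ g ∣ xy.1 ∧ g ∣ xy.2),
        (σ 0 g : ℝ) ^ 2 := by
    rw [sum_filter]
    refine sum_le_sum fun xy hxy => ?_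
    have h1 := one_le_of_mem_box hX hxy
    have hxN : xy.1 ≤ N := by rw [mem_box_iff] at hxy; exact Nat.le_floor hxy.2.1
    split_ifs with hge
    · set g := Nat.gcd xy.1 xy.2 with hg
      have hg1 : 1 ≤ g := Nat.pos_of_ne_zero (by rw [hg, Ne, Nat.gcd_eq_zero_iff]; omega)
      have hgx : g ≤ N := (Nat.le_of_dvd (by omega) (Nat.gcd_dvd_left _ _)).trans hxN
      have hmem : g ∈ (Icc 1 N).filter (fun g : ℕ => G ≤ (g : ℝ) ∧ g ∣ xy.1 ∧ g ∣ xy.2) := by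
        rw [mem_filter, mem_Icc]
        exact ⟨⟨hg1, hgx⟩, hge, Nat.gcd_dvd_left _ _, Nat.gcd_dvd_right _ _⟩
      exact single_le_sum (f := fun g => (σ 0 g : ℝ) ^ 2) (fun _ _ => by positivity) hmem
    · exact sum_nonneg fun _ _ => by positivity
  refine step1.trans ?_
  -- Step 2: swap and count
  rw [sum_comm' (t' := (Icc 1 N).filter (fun g : ℕ => G ≤ (g : ℝ)))
    (s' := fun g => (box X η).filter (fun xy => g ∣ xy.1 ∧ g ∣ xy.2))
    (h := fun xy g => by simp only [mem_filter]; tauto)]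
  have hcount : ∀ g ∈ (Icc 1 N).filter (fun g : ℕ => G ≤ (g : ℝ)),
      (#((box X η).filter (fun xy => g ∣ xy.1 ∧ g ∣ xy.2)) : ℝ) ≤ ((N : ℝ) / g) ^ 2 := by
    intro g hg
    rw [mem_filter, mem_Icc] at hg
    have hg1 := hg.1.1
    have hsub : (box X η).filter (fun xy => g ∣ xy.1 ∧ g ∣ xy.2) ⊆
        ((Ioc 0 N).filter (g ∣ ·)) ×ˢ ((Ioc 0 N).filter (g ∣ ·)) := by
      intro xy hxy
      rw [mem_filter] at hxy
      have h1 := one_le_of_mem_box hX hxy.1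
      have hb : xy.1 ≤ N ∧ xy.2 ≤ N := by
        have := hxy.1; rw [mem_box_iff] at this; exact ⟨Nat.le_floor this.2.1, Nat.le_floor this.2.2.2⟩
      simp only [mem_product, mem_filter, mem_Ioc]
      exact ⟨⟨⟨by omega, hb.1⟩, hxy.2.1⟩, ⟨⟨by omega, hb.2⟩, hxy.2.2⟩⟩
    have hcard := card_le_card hsub
    rw [card_product, Nat.Ioc_filter_dvd_card_eq_div] at hcard
    have hdiv : ((N / g : ℕ) : ℝ) ≤ (N : ℝ) / g := Nat.cast_div_le
    calc (#((box X η).filter (fun xy => g ∣ xy.1 ∧ g ∣ xy.2)) : ℝ) ≤ ((N / g : ℕ) : ℝ) * ((N / g : ℕ) : ℝ) := by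
          exact_mod_cast hcard
      _ ≤ ((N : ℝ) / g) * ((N : ℝ) / g) := mul_le_mul hdiv hdiv (by positivity) (by positivity)
      _ = ((N : ℝ) / g) ^ 2 := by ring
  calc ∑ g ∈ (Icc 1 N).filter (fun g : ℕ => G ≤ (g : ℝ)),
        ∑ _xy ∈ (box X η).filter (fun xy => g ∣ xy.1 ∧ g ∣ xy.2), (σ 0 g : ℝ) ^ 2
      = ∑ g ∈ (Icc 1 N).filter (fun g : ℕ => G ≤ (g : ℝ)),
          #((box X η).filter (fun xy => g ∣ xy.1 ∧ g ∣ xy.2)) * (σ 0 g : ℝ) ^ 2 := by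
        refine sum_congr rfl fun g _ => ?_; rw [sum_const, nsmul_eq_mul]
    _ ≤ ∑ g ∈ (Icc 1 N).filter (fun g : ℕ => G ≤ (g : ℝ)), ((N : ℝ) / g) ^ 2 * (σ 0 g : ℝ) ^ 2 := by
        gcongr with g hg; exact hcount g hg
    _ ≤ ∑ g ∈ (Icc 1 N).filter (fun g : ℕ => G ≤ (g : ℝ)), (N : ℝ) ^ 2 * G⁻¹ * ((σ 0 g : ℝ) ^ 2 / g) := by
        refine sum_le_sum fun g hg => ?_
        rw [mem_filter, mem_Icc] at hg
        have hg0 : (0 : ℝ) < g := by exact_mod_cast hg.1.1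
        have hGg : G⁻¹ ≥ (g : ℝ)⁻¹ := inv_anti₀ hG0 hg.2
        have : ((N : ℝ) / g) ^ 2 * (σ 0 g : ℝ) ^ 2 = (N : ℝ) ^ 2 * (g : ℝ)⁻¹ * ((σ 0 g : ℝ) ^ 2 / g) := by
          field_simp
        rw [this]
        gcongr
    _ ≤ ∑ g ∈ Icc 1 N, (N : ℝ) ^ 2 * G⁻¹ * ((σ 0 g : ℝ) ^ 2 / g) :=
        sum_le_sum_of_subset_of_nonneg (filter_subset _ _) fun _ _ _ => by positivity
    _ = (N : ℝ) ^ 2 * G⁻¹ * ∑ g ∈ Icc 1 N, (σ 0 g : ℝ) ^ 2 / g := by rw [← mul_sum]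

/-- **`E_V ≪ X^{2−τ/2} (log X)^c`** ((11.2)): there are absolute `C, e` such that for `X ≥ 2`,
`0 ≤ η ≤ 1`, `0 < τ ≤ 1`, `T > 0`, every `𝐦` satisfying (3.5)–(3.7) and every `c` as in (3.3),
`|E_V| ≤ C X² (X^τ)^{−1/2} (log X)^e`. [cite: HeathBrownActa2001, §11 (11.2)] -/
theorem exists_errorEV_bound :
    ∃ C e : ℝ, 0 < C ∧ 0 ≤ e ∧ ∀ (X η τ V T : ℝ) (n : ℕ) (m : Fin (n + 1) → ℕ) (c : Ideal (𝓞 K) → ℝ),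
      2 ≤ X → 0 ≤ η → η ≤ 1 → 0 < τ → τ ≤ 1 → 0 < T → CoreAdmissible τ m → CSupport X τ c →
        |errorEV X τ m V T c η| ≤ C * X ^ 2 * (X ^ τ) ^ (-(1 / 2 : ℝ)) * Real.log X ^ e := by
  classical
  obtain ⟨C₄, e₄, hC₄, he₄, h47⟩ := HeathBrown2001_lemma_4_7 4
  obtain ⟨C₂, hC₂, hdiv⟩ := exists_sum_sigma_zero_pow_div_le_real 2
  -- constants
  set CA : ℝ := C₄ * 4 * 4 ^ e₄ with hCA
  set CB : ℝ := 4 * C₂ * 2 ^ 8 with hCB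
  refine ⟨9 * Real.sqrt CA * Real.sqrt CB, e₄ / 2 + 4, by positivity, by positivity, ?_⟩
  intro X η τ V T n m c hX hη0 hη1 hτ hτ1 hT hm hc
  have hX1 : 1 < X := by linarith
  have hX0 : 0 ≤ X := by linarith
  set N : ℕ := ⌊X * (1 + η)⌋₊ with hN
  have hNX : (N : ℝ) ≤ 2 * X := by
    have : (N : ℝ) ≤ X * (1 + η) := Nat.floor_le (by positivity)
    nlinarith
  have hN2 : 2 ≤ N := Nat.le_floor (by push_cast; nlinarith)
  have hN2r : (2 : ℝ) ≤ N := by exact_mod_cast hN2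
  have hlogX : 0 < Real.log X := Real.log_pos hX1
  have hlog2 : Real.log 2 ≤ Real.log X := Real.log_le_log two_pos hX
  have hlogN : Real.log N ≤ 2 * Real.log X := by
    calc Real.log N ≤ Real.log (2 * X) := Real.log_le_log (by positivity) hNX
      _ = Real.log 2 + Real.log X := Real.log_mul two_ne_zero (by positivity)
      _ ≤ 2 * Real.log X := by linarith
  have hlogN0 : 0 ≤ Real.log N := Real.log_nonneg (by linarith)
  -- factor A
  have hA : ∑ xy ∈ box X η, (idealDivisorCount (Ideal.span {pairElt xy}) : ℝ) ^ 4 ≤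
      CA * X ^ 2 * Real.log X ^ e₄ := by
    refine (sum_box_idealDivisorCount_pow_le 4 hX0).trans ((h47 N N hN2 le_rfl).trans ?_)
    have hlogNN : Real.log ((N : ℝ) * N) ≤ 4 * Real.log X := by
      rw [Real.log_mul (by positivity) (by positivity)]; linarith
    have hlogNN0 : 0 ≤ Real.log ((N : ℝ) * N) := Real.log_nonneg (by nlinarith)
    calc C₄ * N * N * Real.log ((N : ℝ) * N) ^ e₄ ≤ C₄ * (2 * X) * (2 * X) * (4 * Real.log X) ^ e₄ := by
          gcongr
      _ = CA * X ^ 2 * Real.log X ^ e₄ := by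
          rw [hCA, Real.mul_rpow (by norm_num) hlogX.le]; ring
  -- factor B
  have hXτ1 : 1 ≤ X ^ τ := Real.one_le_rpow hX1.le hτ.le
  have hXτpos : 0 < X ^ τ := by positivity
  have hB : ∑ xy ∈ (box X η).filter (fun xy => X ^ τ ≤ (Nat.gcd xy.1 xy.2 : ℝ)),
      (σ 0 (Nat.gcd xy.1 xy.2) : ℝ) ^ 2 ≤ CB * X ^ 2 * (X ^ τ)⁻¹ * Real.log X ^ (8 : ℝ) := by
    refine (sum_box_gcd_ge_sigma_sq_le hX0 hXτ1).trans ?_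
    have h2 := hdiv N hN2r
    rw [Nat.floor_natCast] at h2
    have hXτ0 : 0 < (X ^ τ)⁻¹ := by positivity
    calc (N : ℝ) ^ 2 * (X ^ τ)⁻¹ * ∑ g ∈ Icc 1 N, (σ 0 g : ℝ) ^ 2 / g
        ≤ (2 * X) ^ 2 * (X ^ τ)⁻¹ * (C₂ * Real.log N ^ (2 ^ (2 + 1))) := by gcongr
      _ ≤ (2 * X) ^ 2 * (X ^ τ)⁻¹ * (C₂ * (2 * Real.log X) ^ (2 ^ (2 + 1))) := by gcongr
      _ = CB * X ^ 2 * (X ^ τ)⁻¹ * Real.log X ^ (8 : ℝ) := by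
          rw [hCB, show ((8 : ℝ)) = ((8 : ℕ) : ℝ) by norm_num, Real.rpow_natCast]; ring
  -- the square roots
  have eA : (Real.log X ^ (e₄ / 2)) ^ 2 = Real.log X ^ e₄ := by
    rw [← Real.rpow_natCast, ← Real.rpow_mul hlogX.le]; congr 1; push_cast; ring
  have eB : ((X ^ τ) ^ (-(1 / 2 : ℝ))) ^ 2 = (X ^ τ)⁻¹ := by
    rw [← Real.rpow_natCast, ← Real.rpow_mul hXτpos.le,
      show (-(1 / 2 : ℝ)) * ((2 : ℕ) : ℝ) = -1 by push_cast; ring, Real.rpow_neg_one]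
  have e8 : (Real.log X ^ (4 : ℝ)) ^ 2 = Real.log X ^ (8 : ℝ) := by
    rw [← Real.rpow_natCast, ← Real.rpow_mul hlogX.le]; norm_num
  have hsA : Real.sqrt (CA * X ^ 2 * Real.log X ^ e₄) = Real.sqrt CA * X * Real.log X ^ (e₄ / 2) := by
    rw [show CA * X ^ 2 * Real.log X ^ e₄ = (Real.sqrt CA * X * Real.log X ^ (e₄ / 2)) ^ 2 by
      rw [mul_pow, mul_pow, Real.sq_sqrt (by positivity), eA], Real.sqrt_sq (by positivity)]
  have hsB : Real.sqrt (CB * X ^ 2 * (X ^ τ)⁻¹ * Real.log X ^ (8 : ℝ)) =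
      Real.sqrt CB * X * (X ^ τ) ^ (-(1 / 2 : ℝ)) * Real.log X ^ (4 : ℝ) := by
    rw [show CB * X ^ 2 * (X ^ τ)⁻¹ * Real.log X ^ (8 : ℝ) =
      (Real.sqrt CB * X * (X ^ τ) ^ (-(1 / 2 : ℝ)) * Real.log X ^ (4 : ℝ)) ^ 2 by
      rw [mul_pow, mul_pow, mul_pow, Real.sq_sqrt (by positivity), eB, e8], Real.sqrt_sq (by positivity)]
  -- combine
  have hE := abs_errorEV_le_sqrt (η := η) (V := V) hX1 hτ hτ1 hm hc hT
  refine hE.trans ?_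
  have hsqA : Real.sqrt (∑ xy ∈ box X η, (idealDivisorCount (Ideal.span {pairElt xy}) : ℝ) ^ 4) ≤
      Real.sqrt CA * X * Real.log X ^ (e₄ / 2) := hsA ▸ Real.sqrt_le_sqrt hA
  have hsqB : Real.sqrt (∑ xy ∈ (box X η).filter (fun xy => X ^ τ ≤ (Nat.gcd xy.1 xy.2 : ℝ)),
      (σ 0 (Nat.gcd xy.1 xy.2) : ℝ) ^ 2) ≤ Real.sqrt CB * X * (X ^ τ) ^ (-(1 / 2 : ℝ)) * Real.log X ^ (4 : ℝ) :=
    hsB ▸ Real.sqrt_le_sqrt hB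
  have hpow : Real.log X ^ (e₄ / 2) * Real.log X ^ (4 : ℝ) = Real.log X ^ (e₄ / 2 + 4) := by
    rw [← Real.rpow_add hlogX]
  calc 9 * Real.sqrt (∑ xy ∈ box X η, (idealDivisorCount (Ideal.span {pairElt xy}) : ℝ) ^ 4) *
        Real.sqrt (∑ xy ∈ (box X η).filter (fun xy => X ^ τ ≤ (Nat.gcd xy.1 xy.2 : ℝ)),
          (σ 0 (Nat.gcd xy.1 xy.2) : ℝ) ^ 2)
      ≤ 9 * (Real.sqrt CA * X * Real.log X ^ (e₄ / 2)) *
          (Real.sqrt CB * X * (X ^ τ) ^ (-(1 / 2 : ℝ)) * Real.log X ^ (4 : ℝ)) := by gcongr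
    _ = 9 * Real.sqrt CA * Real.sqrt CB * X ^ 2 * (X ^ τ) ^ (-(1 / 2 : ℝ)) *
          (Real.log X ^ (e₄ / 2) * Real.log X ^ (4 : ℝ)) := by ring
    _ = 9 * Real.sqrt CA * Real.sqrt CB * X ^ 2 * (X ^ τ) ^ (-(1 / 2 : ℝ)) * Real.log X ^ (e₄ / 2 + 4) := by
        rw [hpow]

end Literature.NumberTheory.Sieve.CubicSieve

end
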